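import Mathlib
import Summits.QuantumAdvantage.QuantumAdvantage.Theorems.MobiusLadderDigitPolyUniformityDefs
import Summits.QuantumAdvantage.QuantumAdvantage.Theorems.MobiusLadderDigitPolyUniformityLARFinrankLowDeg
import Summits.QuantumAdvantage.QuantumAdvantage.Theorems.MobiusLadderDigitPolyUniformityLARAgreeCount
import Summits.QuantumAdvantage.QuantumAdvantage.Theorems.MobiusLadderDigitPolyUniformityLAREvalMemLowDeg
import Summits.QuantumAdvantage.QuantumAdvantage.Theorems.MobiusLadderDigitPolyUniformityLARTwoPowLe
import Summits.QuantumAdvantage.QuantumAdvantage.Theorems.MobiusLadderDigitPolyUniformityLARChooseMiddleLe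
import Summits.QuantumAdvantage.QuantumAdvantage.Theorems.MobiusLadderDigitPolyUniformityLARCorrLeCard
import Summits.QuantumAdvantage.QuantumAdvantage.Theorems.MobiusLadderDigitPolyUniformityLARShift
import Literature.Computability.MetaComplexity.SmolenskyDimensionBound
import Literature.Computability.MetaComplexity.TruthTables

/-!
# `DigitPolyUniformity` (stmt-QuantumAdvantage-1392), line `Sketch`/LAR — the COMPOSITION, for an
# arbitrary degree function, and what the transferred crux really buys (degree `o(√n)`)

Support file of line `Sketch`/LAR (skeleton `Cruxes/DigitPolyUniformity/Lines/SketchLAR.lean`, lead seat c2).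
The skeleton derives the crux from its single open stub `stub_LAR` (annihilator ranks of the Liouville digit
set `liouSet n` are `≤ ε2ⁿ` at all levels `k ≤ n/2 − ⌈ε√n⌉`). Here the composition is proved once, with the
LAR statement as an explicit HYPOTHESIS and for an ARBITRARY degree function `d : ℕ → ℕ`:

* `corr_le_of_ranks` — the one-sided Smolensky–Carlet bound: for `Q` of total degree `≤ d`, `s ≤ n/2`,
  `Σ_{N<2ⁿ} λ(N)(−1)^{[Q=1]} ≤ 2s·C(n,n/2) + 2·annRank_{n/2−s}(liouSet n) + 2·annRank_{n/2−s+d}((liouSet n)ᶜ) + 1`;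
* `abs_corr_le_of_ranks` — the two-sided form (apply the above to `Q` and to `Q + 1`);
* `uniformity_of_lar` — **LAR ⇒ uniformity of `λ` against every `𝔽₂`-phase of degree `≤ d(n)` whenever
  `d(n) = o(√n)`** (precisely: whenever for every `δ > 0` eventually `d(n) + 1 ≤ δ√n`);
* `sqrt_degree_uniformity_of_lar` — in particular LAR gives, for every `ε > 0`, eventually, correlation
  `≤ ε2ⁿ` for ALL phases of total degree `≤ (ε/16)√n`;
* `eventually_natLog_pow_le_sqrt` — polylogarithms qualify (`(log₂ n)^A + 1 ≤ c√n` eventually), which is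
  how the skeleton's `DigitPolyUniformity_of` becomes a one-line instance of `uniformity_of_lar`.

Reading for the planner (why `stub_LAR` was handed back as crux-sized and must not be promoted to an item
of its own): the transferred statement is not a reformulation of the crux but a STRICTLY LARGER claim —
it contains uniformity up to degree `Θ_ε(√n)`, far beyond the crux's `(log₂ n)^A` and beyond every
printed result (degree `1`, Bourgain 2013) — while the crux only gives LAR back at polylogarithmic levels
(`lar_of_digitPolyUniformity`, `Theorems/…LARInverse`).

All inputs are LANDED support files of the line (`stub_finrank_lowDeg`, `stub_agreeCount`,
`stub_eval_mem_lowDeg`, `stub_two_pow_le`, `stub_choose_middle_le`, `stub_corr_le_card`, the vocabulary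
`annRank`/`liouSet`, and the shift inequality `lar_two_sets_of_one`); no unproved named fact.
-/

noncomputable section

namespace Summit.QuantumAdvantage.DigitPolyUniformity.SketchLAR

open Filter Finset Module
open Literature.Computability.MetaComplexity (boolFunEquivFin)
open Literature.Computability.MetaComplexity.Smolensky (CubeFn mono lowDeg)

/-! ### The one-sided Smolensky–Carlet bound -/

/-- **The one-sided bound**: for `Q` of total degree `≤ d` and a level `k = n/2 − s` (`s ≤ n/2`), with
annihilator ranks `R₁ = annRank_{n/2−s}(liouSet n)` and `R₀ = annRank_{n/2−s+d}((liouSet n)ᶜ)`,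
`Σ_{N<2^n} λ(N)(−1)^{[Q=1]} ≤ 2s·C(n, n/2) + 2R₁ + 2R₀ + 1`. Smolensky–Carlet dimension count
(`stub_agreeCount`) + `dim lowDeg k = Σ_{i≤k} C(n,i)` + the binomial tail `2ⁿ ≤ 2Σ_{i≤n/2−s}C(n,i) + 2sC(n,n/2)`
+ `correlation ≤ 2|agree| − 2ⁿ + 1` (Carlet, CRYPTO 2006, proof of Thm. 1; Smolensky 1987). [folklore] -/
theorem corr_le_of_ranks {n d s : ℕ} (hs : s ≤ n / 2) (Q : MvPolynomial (Fin n) (ZMod 2))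
    (hQ : Q.totalDegree ≤ d) :
    ∑ N ∈ range (2 ^ n), ((ArithmeticFunction.liouville N : ℤ) : ℝ) *
        (if MvPolynomial.eval (fun i : Fin n => if Nat.testBit N i then (1 : ZMod 2) else 0) Q = 1
          then (-1 : ℝ) else 1) ≤
      2 * s * n.choose (n / 2) + 2 * annRank (ZMod 2) n (n / 2 - s) (liouSet n) +
        2 * annRank (ZMod 2) n (n / 2 - s + d) (liouSet n)ᶜ + 1 := by
  classical
  set f : CubeFn (ZMod 2) n := fun b =>
    if ArithmeticFunction.liouville ((boolFunEquivFin n b : Fin (2 ^ n)) : ℕ) = -1 then (1 : ZMod 2)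
    else 0 with hf
  set p : CubeFn (ZMod 2) n := fun b =>
    MvPolynomial.eval (fun i => if b i then (1 : ZMod 2) else 0) Q with hp
  have hpmem : p ∈ lowDeg (ZMod 2) n d := stub_eval_mem_lowDeg Q hQ
  -- the counting lemma with `V₁ = vanishOn liouSet`, `V₀ = vanishOn liouSetᶜ`
  have hV₁ : ∀ h : CubeFn (ZMod 2) n, (∀ b, f b ≠ 0 → h b = 0) →
      h ∈ vanishOn (ZMod 2) (liouSet n) := by
    intro h hh b hb
    refine hh b ?_
    have hb' : ArithmeticFunction.liouville ((boolFunEquivFin n b : Fin (2 ^ n)) : ℕ) = -1 := hb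
    simp only [hf, hb', if_true]
    exact one_ne_zero
  have hV₀ : ∀ h : CubeFn (ZMod 2) n, (∀ b, f b = 0 → h b = 0) →
      h ∈ vanishOn (ZMod 2) (liouSet n)ᶜ := by
    intro h hh b hb
    refine hh b ?_
    have hb' : ¬ ArithmeticFunction.liouville ((boolFunEquivFin n b : Fin (2 ^ n)) : ℕ) = -1 := hb
    simp only [hf, hb', if_false]
  have hcount := stub_agreeCount (k := n / 2 - s) f p hpmem _ _ hV₁ hV₀
  rw [stub_finrank_lowDeg] at hcount
  have htail := stub_two_pow_le n s hs
  have hcorr := stub_corr_le_card (n := n) Q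
  -- `|agree| + |disagree| = 2^n`
  have hAE : (univ.filter fun b : Fin n → Bool => f b = p b).card +
      (univ.filter fun b : Fin n → Bool => f b ≠ p b).card = 2 ^ n := by
    rw [Finset.card_filter_add_card_filter_not, Finset.card_univ, Fintype.card_fun,
      Fintype.card_bool, Fintype.card_fin]
  have hAE' : ((univ.filter fun b : Fin n → Bool => f b = p b).card : ℝ) =
      2 ^ n - (univ.filter fun b : Fin n → Bool => f b ≠ p b).card := by
    have := congrArg (fun m : ℕ => (m : ℝ)) hAE
    push_cast at this
    linarith
  have hcount' : ((∑ i ∈ range (n / 2 - s + 1), n.choose i : ℕ) : ℝ) ≤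
      ((univ.filter fun b : Fin n → Bool => f b ≠ p b).card : ℝ) +
        (annRank (ZMod 2) n (n / 2 - s) (liouSet n) : ℝ) +
        (annRank (ZMod 2) n (n / 2 - s + d) (liouSet n)ᶜ : ℝ) := by
    unfold annRank
    exact_mod_cast hcount
  have htail' : (2 : ℝ) ^ n ≤ 2 * ((∑ i ∈ range (n / 2 - s + 1), n.choose i : ℕ) : ℝ) +
      2 * s * n.choose (n / 2) := by
    exact_mod_cast htail
  have hcorr' := hcorr
  rw [hAE'] at hcorr'
  linarith

/-- `Q + 1` flips the phase: `[(Q+1)(x) = 1] ↔ ¬[Q(x) = 1]` in `𝔽₂`. [folklore] -/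
theorem phase_add_one {n : ℕ} (Q : MvPolynomial (Fin n) (ZMod 2)) (x : Fin n → ZMod 2) :
    (if MvPolynomial.eval x (Q + 1) = 1 then (-1 : ℝ) else 1) =
      -(if MvPolynomial.eval x Q = 1 then (-1 : ℝ) else 1) := by
  rw [map_add, map_one]
  have hv : MvPolynomial.eval x Q = 0 ∨ MvPolynomial.eval x Q = 1 := by
    generalize MvPolynomial.eval x Q = v
    fin_cases v
    · exact Or.inl rfl
    · exact Or.inr rfl
  rcases hv with h | h
  · rw [h]; simp
  · rw [h]; simp only [if_true]
    rw [if_neg (by decide)]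
    norm_num

/-- **The two-sided bound**: for `Q` of total degree `≤ d` and `s ≤ n/2`,
`|Σ_{N<2^n} λ(N)(−1)^{[Q=1]}| ≤ 2s·C(n, n/2) + 2R₁ + 2R₀ + 1` with the annihilator ranks
`R₁ = annRank_{n/2−s}(liouSet n)`, `R₀ = annRank_{n/2−s+d}((liouSet n)ᶜ)` (apply `corr_le_of_ranks` to `Q`
and to `Q + 1`, which has the same degree and the opposite phase). [folklore] -/
theorem abs_corr_le_of_ranks {n d s : ℕ} (hs : s ≤ n / 2) (hd : 1 ≤ d)
    (Q : MvPolynomial (Fin n) (ZMod 2)) (hQ : Q.totalDegree ≤ d) :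
    |∑ N ∈ range (2 ^ n), ((ArithmeticFunction.liouville N : ℤ) : ℝ) *
        (if MvPolynomial.eval (fun i : Fin n => if Nat.testBit N i then (1 : ZMod 2) else 0) Q = 1
          then (-1 : ℝ) else 1)| ≤
      2 * s * n.choose (n / 2) + 2 * annRank (ZMod 2) n (n / 2 - s) (liouSet n) +
        2 * annRank (ZMod 2) n (n / 2 - s + d) (liouSet n)ᶜ + 1 := by
  have hQ1 : (Q + 1).totalDegree ≤ d :=
    (MvPolynomial.totalDegree_add Q 1).trans (max_le hQ (by rw [MvPolynomial.totalDegree_one]; omega))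
  have hup := corr_le_of_ranks hs Q hQ
  have hdown := corr_le_of_ranks hs (Q + 1) hQ1
  have hflip : ∑ N ∈ range (2 ^ n), ((ArithmeticFunction.liouville N : ℤ) : ℝ) *
      (if MvPolynomial.eval (fun i : Fin n => if Nat.testBit N i then (1 : ZMod 2) else 0) (Q + 1) = 1
        then (-1 : ℝ) else 1) =
      -∑ N ∈ range (2 ^ n), ((ArithmeticFunction.liouville N : ℤ) : ℝ) *
        (if MvPolynomial.eval (fun i : Fin n => if Nat.testBit N i then (1 : ZMod 2) else 0) Q = 1
          then (-1 : ℝ) else 1) := by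
    rw [← Finset.sum_neg_distrib]
    refine Finset.sum_congr rfl fun N _ => ?_
    rw [phase_add_one, mul_neg]
  rw [hflip] at hdown
  exact abs_le.2 ⟨by linarith, hup⟩

/-! ### LAR ⇒ uniformity against every degree `o(√n)` -/

/-- **LAR ⇒ uniformity of `λ` against all `𝔽₂`-phases of degree `d(n) = o(√n)`.** Suppose the Liouville
Annihilator Rank statement (the transferred crux `stub_LAR` of line `Sketch`/LAR, here a HYPOTHESIS): for
every `η > 0`, eventually in `n`, `annRank_k(liouSet n) ≤ η2ⁿ` for all `k ≤ n/2 − ⌈η√n⌉`. Then for every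
degree function `d` with `d(n) + 1 ≤ δ√n` eventually for every `δ > 0`, and every `ε > 0`, eventually in
`n`, every `P ∈ 𝔽₂[x_0..x_{n−1}]` of total degree `≤ d(n)` has `|Σ_{N<2ⁿ} λ(N)(−1)^{P(bits N)}| ≤ ε2ⁿ`.
Proof: both annihilator ranks from LAR at `ε/32` (the complement's via the shift inequality,
`lar_two_sets_of_one`), `s = ⌊(ε/8)√n⌋`, levels `n/2 − s` and `n/2 − s + d(n)` admissible because
`d(n) + ⌈(ε/32)√n⌉ ≤ s`, and `2s·C(n,n/2) ≤ (ε/4)2ⁿ` by `C(n,n/2) ≤ 2ⁿ/√n`. [folklore] -/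
theorem uniformity_of_lar
    (hLAR : ∀ η : ℝ, 0 < η → ∀ᶠ n : ℕ in atTop, ∀ k : ℕ, k + ⌈η * Real.sqrt n⌉₊ ≤ n / 2 →
      (annRank (ZMod 2) n k (liouSet n) : ℝ) ≤ η * 2 ^ n)
    (d : ℕ → ℕ) (hd : ∀ δ : ℝ, 0 < δ → ∀ᶠ n : ℕ in atTop, (d n : ℝ) + 1 ≤ δ * Real.sqrt n) :
    ∀ ε : ℝ, 0 < ε → ∀ᶠ n : ℕ in atTop, ∀ P : MvPolynomial (Fin n) (ZMod 2), P.totalDegree ≤ d n →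
      |∑ N ∈ range (2 ^ n), ((ArithmeticFunction.liouville N : ℤ) : ℝ) *
          (if MvPolynomial.eval (fun i : Fin n => if Nat.testBit N i then (1 : ZMod 2) else 0) P = 1
            then (-1 : ℝ) else 1)| ≤ ε * (2 : ℝ) ^ n := by
  intro ε hε
  have hL := lar_two_sets_of_one hLAR (ε / 32) (by positivity)
  have hsqrt : Tendsto (fun n : ℕ => Real.sqrt n) atTop atTop :=
    Real.tendsto_sqrt_atTop.comp tendsto_natCast_atTop_atTop
  have hev1 : ∀ᶠ n : ℕ in atTop, (d n : ℝ) + 1 + 1 ≤ (3 * ε / 32) * Real.sqrt n := by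
    -- `d n + 1 ≤ (3ε/64)√n` and `1 ≤ (3ε/64)√n` eventually
    have h1 := hd (3 * ε / 64) (by positivity)
    have h2 : ∀ᶠ n : ℕ in atTop, 64 / (3 * ε) ≤ Real.sqrt n := hsqrt.eventually_ge_atTop _
    filter_upwards [h1, h2] with n h1n h2n
    have h3 : (1 : ℝ) ≤ 3 * ε / 64 * Real.sqrt n := by
      have := mul_le_mul_of_nonneg_left h2n (show (0 : ℝ) ≤ 3 * ε / 64 by positivity)
      have h' : 3 * ε / 64 * (64 / (3 * ε)) = 1 := by field_simp
      linarith
    linarith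
  have hev2 : ∀ᶠ n : ℕ in atTop, ε / 2 ≤ Real.sqrt n := hsqrt.eventually_ge_atTop _
  have hev3 : ∀ᶠ n : ℕ in atTop, 2 ≤ n := eventually_ge_atTop 2
  have hev4 : ∀ᶠ n : ℕ in atTop, 8 / ε ≤ (2 : ℝ) ^ n :=
    (tendsto_pow_atTop_atTop_of_one_lt one_lt_two).eventually_ge_atTop _
  filter_upwards [hL, hev1, hev2, hev3, hev4] with n hLn h1 h2 h3 h4
  intro P hP
  set s : ℕ := ⌊ε / 8 * Real.sqrt n⌋₊ with hs
  have hsqrt_pos : 0 < Real.sqrt n := Real.sqrt_pos.2 (by exact_mod_cast (show 0 < n by omega))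
  have hs_le : (s : ℝ) ≤ ε / 8 * Real.sqrt n := Nat.floor_le (by positivity)
  -- `(d n + 1) + ⌈(ε/32)√n⌉ ≤ s`
  have hceil_le_s : d n + 1 + ⌈ε / 32 * Real.sqrt n⌉₊ ≤ s := by
    refine Nat.le_floor ?_
    have hc : (⌈ε / 32 * Real.sqrt n⌉₊ : ℝ) < ε / 32 * Real.sqrt n + 1 :=
      Nat.ceil_lt_add_one (by positivity)
    push_cast
    linarith
  -- `s ≤ n/2`
  have hs_half : s ≤ n / 2 := by
    have hreal : ε / 8 * Real.sqrt n ≤ ((n / 2 : ℕ) : ℝ) := by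
      have hn2 : ((n : ℝ) - 1) / 2 ≤ ((n / 2 : ℕ) : ℝ) := by
        have hcast : ((n / 2 : ℕ) : ℝ) * 2 + ((n % 2 : ℕ) : ℝ) = n := by
          exact_mod_cast (by omega)
        have hmod' : ((n % 2 : ℕ) : ℝ) ≤ 1 := by exact_mod_cast (by omega)
        linarith
      have hsq : Real.sqrt n * Real.sqrt n = n := Real.mul_self_sqrt (Nat.cast_nonneg n)
      have hn1 : (2 : ℝ) ≤ n := by exact_mod_cast h3
      have hA : ε / 8 * Real.sqrt n ≤ Real.sqrt n * Real.sqrt n / 4 := by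
        have := mul_le_mul_of_nonneg_right h2 hsqrt_pos.le
        linarith
      rw [hsq] at hA
      linarith
    exact_mod_cast hs_le.trans hreal
  -- the two-sided bound at degree `d n + 1 ≥ 1`
  have hc := abs_corr_le_of_ranks (d := d n + 1) hs_half (by omega) P (by omega)
  -- the two annihilator ranks, from LAR
  have hk1 : n / 2 - s + ⌈ε / 32 * Real.sqrt n⌉₊ ≤ n / 2 := by omega
  have hk2 : n / 2 - s + (d n + 1) + ⌈ε / 32 * Real.sqrt n⌉₊ ≤ n / 2 := by omega
  have hR₁ := (hLn (n / 2 - s) hk1).1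
  have hR₀ := (hLn (n / 2 - s + (d n + 1)) hk2).2
  -- the middle binomial coefficient
  have hmid := stub_choose_middle_le n (by omega)
  have hsC : 2 * (s : ℝ) * n.choose (n / 2) ≤ ε / 4 * 2 ^ n := by
    calc 2 * (s : ℝ) * n.choose (n / 2) ≤ 2 * (ε / 8 * Real.sqrt n) * (2 ^ n / Real.sqrt n) :=
          mul_le_mul (mul_le_mul_of_nonneg_left hs_le zero_le_two) hmid (Nat.cast_nonneg _)
            (by positivity)
      _ = ε / 4 * 2 ^ n := by
          field_simp
          ring
  have h8 : (1 : ℝ) ≤ ε / 8 * 2 ^ n := by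
    have := mul_le_mul_of_nonneg_left h4 (show (0 : ℝ) ≤ ε / 8 by positivity)
    have h' : ε / 8 * (8 / ε) = 1 := by field_simp
    linarith
  linarith

/-- **What the transferred crux buys: degree `Θ_ε(√n)`.** Under the LAR hypothesis, for every `ε > 0`,
eventually in `n`, EVERY `P ∈ 𝔽₂[x_0..x_{n−1}]` of total degree `≤ (ε/16)√n` has
`|Σ_{N<2ⁿ} λ(N)(−1)^{P(bits N)}| ≤ ε2ⁿ` — a statement strictly containing the crux `DigitPolyUniformity`
(degree `(log₂ n)^A`) and far beyond print (degree `1`, Bourgain 2013). [folklore] -/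
theorem sqrt_degree_uniformity_of_lar
    (hLAR : ∀ η : ℝ, 0 < η → ∀ᶠ n : ℕ in atTop, ∀ k : ℕ, k + ⌈η * Real.sqrt n⌉₊ ≤ n / 2 →
      (annRank (ZMod 2) n k (liouSet n) : ℝ) ≤ η * 2 ^ n) :
    ∀ ε : ℝ, 0 < ε → ∀ᶠ n : ℕ in atTop, ∀ P : MvPolynomial (Fin n) (ZMod 2),
      (P.totalDegree : ℝ) ≤ ε / 16 * Real.sqrt n →
      |∑ N ∈ range (2 ^ n), ((ArithmeticFunction.liouville N : ℤ) : ℝ) *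
          (if MvPolynomial.eval (fun i : Fin n => if Nat.testBit N i then (1 : ZMod 2) else 0) P = 1
            then (-1 : ℝ) else 1)| ≤ ε * (2 : ℝ) ^ n := by
  intro ε hε
  -- degree function `d n = ⌊(ε/16)√n⌋`: then `d n + 1 ≤ (ε/16)√n + 1 ≤ δ√n` fails for small `δ`, so we
  -- run the composition directly instead of through `uniformity_of_lar`: same constants as there with
  -- `d n + 1 + 1 ≤ (3ε/32)√n`, which holds since `(ε/16)√n + 2 ≤ (3ε/32)√n` iff `64/ε ≤ √n`.
  have hL := lar_two_sets_of_one hLAR (ε / 32) (by positivity)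
  have hsqrt : Tendsto (fun n : ℕ => Real.sqrt n) atTop atTop :=
    Real.tendsto_sqrt_atTop.comp tendsto_natCast_atTop_atTop
  have hev1 : ∀ᶠ n : ℕ in atTop, 64 / ε ≤ Real.sqrt n := hsqrt.eventually_ge_atTop _
  have hev2 : ∀ᶠ n : ℕ in atTop, ε / 2 ≤ Real.sqrt n := hsqrt.eventually_ge_atTop _
  have hev3 : ∀ᶠ n : ℕ in atTop, 2 ≤ n := eventually_ge_atTop 2
  have hev4 : ∀ᶠ n : ℕ in atTop, 8 / ε ≤ (2 : ℝ) ^ n :=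
    (tendsto_pow_atTop_atTop_of_one_lt one_lt_two).eventually_ge_atTop _
  filter_upwards [hL, hev1, hev2, hev3, hev4] with n hLn h1 h2 h3 h4
  intro P hP
  set s : ℕ := ⌊ε / 8 * Real.sqrt n⌋₊ with hs
  have hsqrt_pos : 0 < Real.sqrt n := Real.sqrt_pos.2 (by exact_mod_cast (show 0 < n by omega))
  have hs_le : (s : ℝ) ≤ ε / 8 * Real.sqrt n := Nat.floor_le (by positivity)
  have hdeg2 : (P.totalDegree : ℝ) + 1 + 1 ≤ 3 * ε / 32 * Real.sqrt n := by
    have h3' : (2 : ℝ) ≤ ε / 32 * Real.sqrt n := by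
      have := mul_le_mul_of_nonneg_left h1 (show (0 : ℝ) ≤ ε / 32 by positivity)
      have h' : ε / 32 * (64 / ε) = 2 := by field_simp; ring
      linarith
    linarith
  have hceil_le_s : P.totalDegree + 1 + ⌈ε / 32 * Real.sqrt n⌉₊ ≤ s := by
    refine Nat.le_floor ?_
    have hc : (⌈ε / 32 * Real.sqrt n⌉₊ : ℝ) < ε / 32 * Real.sqrt n + 1 :=
      Nat.ceil_lt_add_one (by positivity)
    push_cast
    linarith
  have hs_half : s ≤ n / 2 := by
    have hreal : ε / 8 * Real.sqrt n ≤ ((n / 2 : ℕ) : ℝ) := by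
      have hn2 : ((n : ℝ) - 1) / 2 ≤ ((n / 2 : ℕ) : ℝ) := by
        have hcast : ((n / 2 : ℕ) : ℝ) * 2 + ((n % 2 : ℕ) : ℝ) = n := by
          exact_mod_cast (by omega)
        have hmod' : ((n % 2 : ℕ) : ℝ) ≤ 1 := by exact_mod_cast (by omega)
        linarith
      have hsq : Real.sqrt n * Real.sqrt n = n := Real.mul_self_sqrt (Nat.cast_nonneg n)
      have hn1 : (2 : ℝ) ≤ n := by exact_mod_cast h3
      have hA : ε / 8 * Real.sqrt n ≤ Real.sqrt n * Real.sqrt n / 4 := by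
        have := mul_le_mul_of_nonneg_right h2 hsqrt_pos.le
        linarith
      rw [hsq] at hA
      linarith
    exact_mod_cast hs_le.trans hreal
  have hc := abs_corr_le_of_ranks (d := P.totalDegree + 1) hs_half (by omega) P (by omega)
  have hk1 : n / 2 - s + ⌈ε / 32 * Real.sqrt n⌉₊ ≤ n / 2 := by omega
  have hk2 : n / 2 - s + (P.totalDegree + 1) + ⌈ε / 32 * Real.sqrt n⌉₊ ≤ n / 2 := by omega
  have hR₁ := (hLn (n / 2 - s) hk1).1
  have hR₀ := (hLn (n / 2 - s + (P.totalDegree + 1)) hk2).2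
  have hmid := stub_choose_middle_le n (by omega)
  have hsC : 2 * (s : ℝ) * n.choose (n / 2) ≤ ε / 4 * 2 ^ n := by
    calc 2 * (s : ℝ) * n.choose (n / 2) ≤ 2 * (ε / 8 * Real.sqrt n) * (2 ^ n / Real.sqrt n) :=
          mul_le_mul (mul_le_mul_of_nonneg_left hs_le zero_le_two) hmid (Nat.cast_nonneg _)
            (by positivity)
      _ = ε / 4 * 2 ^ n := by
          field_simp
          ring
  have h8 : (1 : ℝ) ≤ ε / 8 * 2 ^ n := by
    have := mul_le_mul_of_nonneg_left h4 (show (0 : ℝ) ≤ ε / 8 by positivity)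
    have h' : ε / 8 * (8 / ε) = 1 := by field_simp
    linarith
  linarith

/-! ### Polylogarithms are `o(√n)` (the crux's degree qualifies) -/

/-- `Nat.log 2 n ≤ 2 log n` (from `2^{Nat.log 2 n} ≤ n` and `log 2 > 1/2`). [folklore] -/
theorem natLog_two_le_two_mul_log {n : ℕ} (hn : n ≠ 0) :
    (Nat.log 2 n : ℝ) ≤ 2 * Real.log n := by
  have h := Nat.pow_log_le_self 2 hn
  have hcast : (2 : ℝ) ^ Nat.log 2 n ≤ n := by exact_mod_cast h
  have hlog := Real.log_le_log (by positivity) hcast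
  rw [Real.log_pow] at hlog
  have h2 : (0.6931471803 : ℝ) < Real.log 2 := Real.log_two_gt_d9
  have hL : 0 ≤ (Nat.log 2 n : ℝ) := Nat.cast_nonneg _
  nlinarith

/-- **Polylogarithms are eventually below any multiple of `√n`**: for every `A` and `c > 0`, eventually
`(Nat.log 2 n)^A + 1 ≤ c √n` (Mathlib's `isLittleO_log_rpow_rpow_atTop`). [folklore] -/
theorem eventually_natLog_pow_le_sqrt (A : ℕ) {c : ℝ} (hc : 0 < c) :
    ∀ᶠ n : ℕ in atTop, ((Nat.log 2 n : ℝ) ^ A) + 1 ≤ c * Real.sqrt n := by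
  have hlo := isLittleO_log_rpow_rpow_atTop (A : ℝ) (show (0 : ℝ) < 1 / 2 by norm_num)
  have hc' : 0 < c / (2 * 2 ^ A) := by positivity
  have hb := tendsto_natCast_atTop_atTop.eventually (hlo.bound hc')
  have hsqrt : Tendsto (fun n : ℕ => Real.sqrt n) atTop atTop :=
    Real.tendsto_sqrt_atTop.comp tendsto_natCast_atTop_atTop
  have h1 : ∀ᶠ n : ℕ in atTop, 2 / c ≤ Real.sqrt n := hsqrt.eventually_ge_atTop _
  have h2 : ∀ᶠ n : ℕ in atTop, 2 ≤ n := eventually_ge_atTop 2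
  filter_upwards [hb, h1, h2] with n hbn h1n h2n
  have hn0 : n ≠ 0 := by omega
  have hlogpos : 0 ≤ Real.log n := Real.log_nonneg (by exact_mod_cast (show 1 ≤ n by omega))
  rw [Real.rpow_natCast, Real.norm_of_nonneg (pow_nonneg hlogpos A), ← Real.sqrt_eq_rpow,
    Real.norm_of_nonneg (Real.sqrt_nonneg _)] at hbn
  have hNL : (Nat.log 2 n : ℝ) ^ A ≤ 2 ^ A * Real.log n ^ A := by
    rw [← mul_pow]
    exact pow_le_pow_left₀ (Nat.cast_nonneg _) (natLog_two_le_two_mul_log hn0) A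
  have hmid : (2 : ℝ) ^ A * Real.log n ^ A ≤ c / 2 * Real.sqrt n := by
    calc (2 : ℝ) ^ A * Real.log n ^ A ≤ 2 ^ A * (c / (2 * 2 ^ A) * Real.sqrt n) :=
          mul_le_mul_of_nonneg_left hbn (by positivity)
      _ = c / 2 * Real.sqrt n := by
          field_simp
  have hone : (1 : ℝ) ≤ c / 2 * Real.sqrt n := by
    have := mul_le_mul_of_nonneg_left h1n (show (0 : ℝ) ≤ c / 2 by positivity)
    have h' : c / 2 * (2 / c) = 1 := by field_simp
    linarith
  linarith

/-- The crux's degree function `n ↦ (log₂ n)^A` is admissible for `uniformity_of_lar`: for every `δ > 0`,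
eventually `(Nat.log 2 n)^A + 1 ≤ δ√n` (cast form of `eventually_natLog_pow_le_sqrt`). [folklore] -/
theorem natLog_pow_admissible (A : ℕ) :
    ∀ δ : ℝ, 0 < δ → ∀ᶠ n : ℕ in atTop, (((Nat.log 2 n ^ A : ℕ) : ℝ)) + 1 ≤ δ * Real.sqrt n := by
  intro δ hδ
  filter_upwards [eventually_natLog_pow_le_sqrt A hδ] with n hn
  push_cast
  exact hn

/-- **LAR ⇒ the crux's conclusion** (hypothesis form of the skeleton's `DigitPolyUniformity_of`): under the
LAR hypothesis, for every `A` and `ε > 0`, eventually in `n`, every `P` of total degree `≤ (log₂ n)^A` has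
`|Σ_{N<2ⁿ} λ(N)(−1)^{P(bits N)}| ≤ ε2ⁿ`. One line from `uniformity_of_lar`. [folklore] -/
theorem polylog_degree_uniformity_of_lar
    (hLAR : ∀ η : ℝ, 0 < η → ∀ᶠ n : ℕ in atTop, ∀ k : ℕ, k + ⌈η * Real.sqrt n⌉₊ ≤ n / 2 →
      (annRank (ZMod 2) n k (liouSet n) : ℝ) ≤ η * 2 ^ n) (A : ℕ) :
    ∀ ε : ℝ, 0 < ε → ∀ᶠ n : ℕ in atTop, ∀ P : MvPolynomial (Fin n) (ZMod 2),
      P.totalDegree ≤ Nat.log 2 n ^ A →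
      |∑ N ∈ range (2 ^ n), ((ArithmeticFunction.liouville N : ℤ) : ℝ) *
          (if MvPolynomial.eval (fun i : Fin n => if Nat.testBit N i then (1 : ZMod 2) else 0) P = 1
            then (-1 : ℝ) else 1)| ≤ ε * (2 : ℝ) ^ n :=
  uniformity_of_lar hLAR (fun n => Nat.log 2 n ^ A) (natLog_pow_admissible A)

end Summit.QuantumAdvantage.DigitPolyUniformity.SketchLAR

end
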